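import Summits.ResolutionOfSingularities.ResolutionOfSingularities.Theorems.ValuativeLuAlphaPTorsorAdaptedDefs
import Summits.ResolutionOfSingularities.ResolutionOfSingularities.Theorems.ValuativeLuAlphaPTorsorAPDict
import Summits.ResolutionOfSingularities.ResolutionOfSingularities.Theorems.ValuativeLuAlphaPTorsorAPLift
import Summits.ResolutionOfSingularities.ResolutionOfSingularities.Theorems.ValuativeLuAlphaPTorsorAPOne
import Summits.ResolutionOfSingularities.ResolutionOfSingularities.Theorems.ValuativeLuAlphaPTorsorAPStep1
import Literature.AlgebraicGeometry.Resolution.CompositeValuations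
import Mathlib.RingTheory.FiniteType
import Mathlib.RingTheory.Noetherian.Basic
import Mathlib.Algebra.Algebra.Subalgebra.Lattice
import HarnessLib

/-!
# S3* level induction, step 1 (v2): lifting the residual re-parametrization (the rings `B = R₁[u]`, `R₃ = B[z]`)

Crux `Valuative.LuAlphaPTorsor` (stmt-ResolutionOfSingularities-0641), line `pfaff-line-log-final-forms`,
lead seat c4 — `ap_adaptedPerron` (`…AdaptedPerron`), the Perron monomialization on flag-adapted
charts in any rank, split by the 400-line rule. STEP 1 of the induction step (`ap_ap_step1`,
registered anchor `ap_ap_step1b_aux`; this file supersedes `…APStep1` (imported for its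
anchor lemma), whose statement lacked the defining equation of `B`): given the rank-one monomialization
`R₁ = R[x_T']` on the top coarsening `W` and the residual re-parametrization `x̄' = x̄^{C'}` of the
induction hypothesis, LIFT `u = x_S^{C'}`, form `B = R₁[u]`, find one exponent `N₀` throwing the
`W`-small elements of `B` into `(x_T')B` (noetherianity), and the type-2 transform
`z_t = x'_{T,t} / (Q^{N₀} E_t)` with `R₃ = B[z]` a `W`-chart whose image in `κ(W)` is the
re-parametrized residual chart. [folklore] (Zariski 1940; Cutkosky 2022 §4.)
-/

set_option linter.dupNamespace false

open IsLocalRing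

namespace Summit.ResolutionOfSingularities.ResolutionOfSingularities.Theorems.PfaffLine

open Literature.AlgebraicGeometry.Resolution

/-- Anchor (closed form): a `W`-small element lies in `W` and is not a unit. [folklore] -/
theorem ap_ap_step1b_aux : ∀ {K : Type} [Field K] (W : ValuationSubring K) (z : K), W.valuation z < 1 → z ∈ W ∧ W.valuation z ≠ 1 := by
  intro K _ W z hz
  exact ⟨(W.valuation_le_one_iff z).mp hz.le, ne_of_lt hz⟩

set_option maxHeartbeats 800000 in
/-- **STEP 1 of the induction step of S3***: lift, clear denominators uniformly, type-2 transform.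
Everything the later steps need is recorded in the conclusion. [folklore] -/
theorem ap_ap_step1b {k K : Type} [Field k] [Field K] [Algebra k K] (O : ValuationSubring K)
    (hk : ∀ c : k, algebraMap k K c ∈ O) {n : ℕ} (R : Subalgebra k K) (hRO : R.toSubring ≤ O.toSubring)
    (x : Fin n → K) (hx : ∀ i, x i ∈ R) (lv : Fin n → ℕ) (top : ℕ) (hx0 : ∀ i, x i ≠ 0)
    (i₀ : Fin n) (hi₀ : lv i₀ = top)
    (W : ValuationSubring K) (hOW : O ≤ W) (hWlow : ∀ i, lv i < top → W.valuation (x i) = 1)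
    (hWO : ∀ z : K, W.valuation z < 1 → O.valuation z < 1)
    {nT : ℕ} (eT : Fin nT ≃ {i : Fin n // lv i = top})
    (hWind : ∀ m : Fin nT → ℤ, (∏ t, W.valuation (x (eT t)) ^ (m t)) = 1 → m = 0)
    {nS : ℕ} (eS : Fin nS ≃ {i : Fin n // lv i < top})
    (hlowW : ∀ i, lv i < top → x i ∈ W ∧ (x i)⁻¹ ∈ W)
    [Algebra k (ResidueField W)] (Rb : Subalgebra k (ResidueField W))
    (hπsurj : ∀ rb ∈ Rb, ∃ (r : K) (hr : r ∈ R), residue W ⟨r, hOW (hRO hr)⟩ = rb)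
    (halg : ∀ c : k, algebraMap k (ResidueField W) c = residue W ⟨algebraMap k K c, hOW (hk c)⟩)
    (hxbb0 : ∀ s, residue W ⟨x (eS s).1, hOW (hRO (hx (eS s).1))⟩ ≠ 0)
    (hbind : ∀ m : Fin nS → ℤ, (∏ s, (residueValuationSubring O W hOW).valuation
      (residue W ⟨x (eS s).1, hOW (hRO (hx (eS s).1))⟩) ^ (m s)) = 1 → m = 0)
    (R₁ : Subalgebra k K) (hR₁W : R₁.toSubring ≤ W.toSubring) (xT : Fin nT → K) (hxT : ∀ t, xT t ∈ R₁)
    (hRR₁ : R ≤ R₁) (hR₁FG : R₁.FG) (hxT0 : ∀ t, xT t ≠ 0)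
    (hspan₁ : Ideal.span (Set.range fun t => (⟨xT t, hxT t⟩ : R₁.toSubring)) =
      Ideal.comap (Subring.inclusion hR₁W) (maximalIdeal W))
    {l : ℕ} (h : Fin l → Fin n → ℤ)
    (hhj₁ : ∀ j, ∃ e : Fin nT → ℕ, (∏ t, x (eT t) ^ (h j (eT t))) = ∏ t, xT t ^ (e t))
    (hxTlt : ∀ t, W.valuation (xT t) < 1) (hR₁O : R₁.toSubring ≤ O.toSubring)
    (hπR₁ : ∀ (r : K) (hr : r ∈ R₁), residue W ⟨r, hOW (hR₁O hr)⟩ ∈ Rb)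
    (Rb' : Subalgebra k (ResidueField W))
    (hRb'O : Rb'.toSubring ≤ (residueValuationSubring O W hOW).toSubring)
    (xb' : Fin nS → ResidueField W) (hxb' : ∀ s, xb' s ∈ Rb') (hRbRb' : Rb ≤ Rb')
    (hRb'eq : Rb' = Algebra.adjoin k ((Rb : Set (ResidueField W)) ∪ Set.range xb'))
    (hbspan' : Ideal.span (Set.range fun s => (⟨xb' s, hxb' s⟩ : Rb'.toSubring)) =
      Ideal.comap (Subring.inclusion hRb'O) (maximalIdeal (residueValuationSubring O W hOW)))
    (C' : Fin nS → Fin nS → ℤ)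
    (hC' : ∀ s, xb' s = ∏ s1, residue W ⟨x (eS s1).1, hOW (hRO (hx (eS s1).1))⟩ ^ (C' s s1))
    (D' : Fin nS → Fin nS → ℕ)
    (hD' : ∀ s, residue W ⟨x (eS s).1, hOW (hRO (hx (eS s).1))⟩ = ∏ s1, xb' s1 ^ (D' s s1))
    {ma : ℕ} (β : Fin ma → Fin nS → ℕ) :
    ∃ (u : Fin nS → K) (huW : ∀ s, u s ∈ W) (Q : K) (B : Subalgebra k K)
      (hBW : B.toSubring ≤ W.toSubring) (_ : B.toSubring ≤ O.toSubring) (N₀ : ℕ)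
      (tsel : Fin l → Fin nT) (e₁ : Fin l → Fin nT → ℕ) (g : Fin l → Fin nS → ℤ)
      (mv : Fin nT → Fin nS → ℕ) (bsum : Fin nS → ℕ) (dv : Fin nT → Fin nS → ℕ) (E : Fin nT → K)
      (z : Fin nT → K) (R₃ : Subalgebra k K) (_ : R₃.toSubring ≤ O.toSubring)
      (hR₃W : R₃.toSubring ≤ W.toSubring) (hzR₃ : ∀ t, z t ∈ R₃) (hxTB : ∀ t, xT t ∈ B) (hQB : Q ∈ B)
      (_ : B ≤ R₃),
      u = (fun s => ∏ s1, x (eS s1) ^ (C' s s1)) ∧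
      B = Algebra.adjoin k ((R₁ : Set K) ∪ Set.range u) ∧
      (∀ s, W.valuation (u s) = 1) ∧ (∀ s, u s ≠ 0) ∧
      (∀ s, residue W ⟨u s, huW s⟩ = xb' s) ∧ (∀ s, O.valuation (u s) < 1) ∧
      (∀ s1, x (eS s1) = ∏ s, u s ^ ((D' s1 s : ℤ))) ∧
      Q ≠ 0 ∧ R₁ ≤ B ∧ (∀ s, u s ∈ B) ∧
      (∀ (τ : K) (hτ : τ ∈ B), W.valuation τ < 1 →
        (⟨Q ^ N₀ * τ, mul_mem (pow_mem hQB N₀) hτ⟩ : B.toSubring) ∈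
          Ideal.span (Set.range fun t => (⟨xT t, hxTB t⟩ : B.toSubring))) ∧
      (∀ j, (¬ ∀ t, h j (eT t) = 0) → e₁ j (tsel j) ≠ 0) ∧
      (∀ j, (∏ t, x (eT t) ^ (h j (eT t))) = ∏ t, xT t ^ (e₁ j t)) ∧
      (∀ j, (∏ s1, x (eS s1) ^ (h j (eS s1))) = ∏ s, u s ^ (g j s)) ∧
      (∀ j s, (g j s).natAbs ≤ mv (tsel j) s) ∧
      (∀ t s, mv t s ≤ dv t s) ∧
      (∀ j s, β j s ≤ bsum s) ∧
      E = (fun t => ∏ s, u s ^ (bsum s + mv t s)) ∧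
      (∀ t, Q ^ N₀ * E t = ∏ s, u s ^ (dv t s : ℤ)) ∧
      z = (fun t => xT t / (Q ^ N₀ * E t)) ∧
      (∀ t, W.valuation (z t) = W.valuation (xT t)) ∧ (∀ t, W.valuation (z t) < 1) ∧ (∀ t, z t ≠ 0) ∧
      R₃ = Algebra.adjoin k ((B : Set K) ∪ Set.range z) ∧
      Ideal.span (Set.range fun t => (⟨z t, hzR₃ t⟩ : R₃.toSubring)) =
        Ideal.comap (Subring.inclusion hR₃W) (maximalIdeal W) ∧
      (∀ t, xT t = z t * ∏ s, u s ^ (dv t s : ℤ)) ∧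
      (∀ (w : K) (hw : w ∈ R₃), residue W ⟨w, hR₃W hw⟩ ∈ Rb') ∧
      (∀ rb ∈ Rb', ∃ (w : K) (hw : w ∈ R₃), residue W ⟨w, hR₃W hw⟩ = rb) ∧
      (∀ rb ∈ Rb', ∃ (w : K) (hw : w ∈ B), residue W ⟨w, hBW hw⟩ = rb) ∧
      (∀ (b : Fin nS → ℕ) (hb : (∏ s, u s ^ (b s)) ∈ W), residue W ⟨∏ s, u s ^ (b s), hb⟩ = ∏ s, xb' s ^ (b s)) ∧
      (∀ b : Fin nS → ℕ, (∏ s, u s ^ (b s)) ∈ B) ∧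
      R₃.FG := by
  classical
  set Ob := residueValuationSubring O W hOW with hOb
  -- Laurent monomials in the lower parameters
  have hmonW : ∀ m : Fin nS → ℤ, (∏ s, x (eS s) ^ (m s)) ∈ W := fun m =>
    ap_ap_step1_anchor W (fun s => x (eS s)) (fun s => hlowW _ (eS s).2) m
  have hmonu : ∀ m : Fin nS → ℤ, W.valuation (∏ s, x (eS s) ^ (m s)) = 1 := by
    intro m; rw [map_prod]; exact Finset.prod_eq_one fun s _ => by rw [map_zpow₀, hWlow _ (eS s).2, one_zpow]
  have hmonπ : ∀ m : Fin nS → ℤ, residue W ⟨∏ s, x (eS s) ^ (m s), hmonW m⟩ =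
      ∏ s, residue W ⟨x (eS s).1, hOW (hRO (hx (eS s).1))⟩ ^ (m s) :=
    fun m => ap_residue_prod_zpow W (fun s => x (eS s)) (fun s => (hlowW _ (eS s).2).1)
      (fun s => (hlowW _ (eS s).2).2) (fun s => hx0 _) m (hmonW m)
  -- STEP 3: LIFT the residual parameters: `u s = x_S ^ (C' s)`
  set u : Fin nS → K := fun s => ∏ s1, x (eS s1) ^ (C' s s1) with hu
  have huW : ∀ s, u s ∈ W := fun s => hmonW (C' s)
  have huWi : ∀ s, (u s)⁻¹ ∈ W := by
    intro s
    have : (u s)⁻¹ = ∏ s1, x (eS s1) ^ ((-C' s) s1) := by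
      rw [hu, ← Finset.prod_inv_distrib]
      exact Finset.prod_congr rfl fun s1 _ => by rw [Pi.neg_apply, zpow_neg]
    rw [this]; exact hmonW (-C' s)
  have huu : ∀ s, W.valuation (u s) = 1 := fun s => hmonu (C' s)
  have hu0 : ∀ s, u s ≠ 0 := fun s => ap_prod_zpow_ne_zero _ (fun s1 => hx0 _) _
  have huπ : ∀ s, residue W ⟨u s, huW s⟩ = xb' s := by
    intro s; rw [hC' s]; exact hmonπ (C' s)
  have huv : ∀ s, O.valuation (u s) < 1 := by
    intro s
    have h1 : Ob.valuation (xb' s) < 1 := by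
      have : (⟨xb' s, hxb' s⟩ : Rb'.toSubring) ∈ Ideal.comap (Subring.inclusion hRb'O) (maximalIdeal Ob) := by
        rw [← hbspan']; exact Ideal.subset_span ⟨s, rfl⟩
      rw [Ideal.mem_comap, ValuationSubring.valuation_lt_one_iff] at this
      exact this
    rw [← huπ s, ap_resval_lt_one_iff O W hOW (huW s) (huu s)] at h1
    exact h1
  have huO : ∀ s, u s ∈ O := fun s => (O.valuation_le_one_iff _).mp (huv s).le
  -- `D' C' = 1`: the old lower parameters are ℕ-monomials in the `u`
  have hDC : ∀ s1 s2 : Fin nS, (∑ s, (D' s1 s : ℤ) * C' s s2) = if s1 = s2 then 1 else 0 := by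
    intro s1 s2
    have hx' : residue W ⟨x (eS s1).1, hOW (hRO (hx (eS s1).1))⟩ =
        ∏ s3, residue W ⟨x (eS s3).1, hOW (hRO (hx (eS s3).1))⟩ ^ (∑ s, (D' s1 s : ℤ) * C' s s3) := by
      conv_lhs => rw [hD' s1, ap_prod_pow_eq_zpow]
      simp_rw [hC']
      exact ap_prod_zpow_matrix _ (fun s => hxbb0 s) C' (fun s => (D' s1 s : ℤ))
    have h1 : (∏ s3, Ob.valuation (residue W ⟨x (eS s3).1, hOW (hRO (hx (eS s3).1))⟩) ^
        ((fun s2 => ∑ s, (D' s1 s : ℤ) * C' s s2) s3)) =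
        ∏ s3, Ob.valuation (residue W ⟨x (eS s3).1, hOW (hRO (hx (eS s3).1))⟩) ^
          ((Pi.single s1 (1 : ℤ) : Fin nS → ℤ) s3) := by
      have hl : (∏ s3, Ob.valuation (residue W ⟨x (eS s3).1, hOW (hRO (hx (eS s3).1))⟩) ^
          ((fun s2 => ∑ s, (D' s1 s : ℤ) * C' s s2) s3)) =
          Ob.valuation (residue W ⟨x (eS s1).1, hOW (hRO (hx (eS s1).1))⟩) := by
        rw [hx', map_prod]
        exact Finset.prod_congr rfl fun j _ => (map_zpow₀ _ _ _).symm
      have hr : (∏ s3, Ob.valuation (residue W ⟨x (eS s3).1, hOW (hRO (hx (eS s3).1))⟩) ^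
          ((Pi.single s1 (1 : ℤ) : Fin nS → ℤ) s3)) =
          Ob.valuation (residue W ⟨x (eS s1).1, hOW (hRO (hx (eS s1).1))⟩) := by
        rw [Finset.prod_eq_single s1 (fun j _ hj => by simp [hj]) (by simp)]
        simp
      rw [hl, hr]
    have h2 := ap_exp_eq_of_prod_eq _ (fun s => (map_ne_zero _).mpr (hxbb0 s)) hbind _ _ h1
    have h3 := congrFun h2 s2
    simp only [Pi.single_apply] at h3
    rw [h3]
    by_cases h : s1 = s2
    · subst h; simp
    · rw [if_neg (Ne.symm h), if_neg h]
  have hxu : ∀ s1, x (eS s1) = ∏ s, u s ^ ((D' s1 s : ℤ)) := by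
    intro s1
    rw [hu]
    rw [ap_prod_zpow_matrix _ (fun s => hx0 _) C' (fun s => (D' s1 s : ℤ))]
    rw [Finset.prod_eq_single s1 (fun j _ hj => by rw [hDC, if_neg (Ne.symm hj), zpow_zero]) (by simp)]
    rw [hDC, if_pos rfl, zpow_one]
  -- the common denominator `Q = x_S ^ qv`
  set qv : Fin nS → ℕ := fun s1 => ∑ s, (C' s s1).natAbs with hqv
  set Q : K := ∏ s1, x (eS s1) ^ (qv s1) with hQ
  have hQR : Q ∈ R := prod_mem fun s1 _ => pow_mem (hx _) _
  have hQ0 : Q ≠ 0 := Finset.prod_ne_zero_iff.mpr fun s1 _ => pow_ne_zero _ (hx0 _)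
  have hQu1 : W.valuation Q = 1 := by
    rw [hQ, map_prod]; exact Finset.prod_eq_one fun s1 _ => by rw [map_pow, hWlow _ (eS s1).2, one_pow]
  have hQW : Q ∈ W := hOW (hRO hQR)
  have hQu : ∀ s, Q * u s ∈ R := by
    intro s
    have hnn : ∀ s1, 0 ≤ (qv s1 : ℤ) + C' s s1 := by
      intro s1
      have : (C' s s1).natAbs ≤ qv s1 := by
        rw [hqv]; exact Finset.single_le_sum (f := fun s => (C' s s1).natAbs) (fun _ _ => Nat.zero_le _) (Finset.mem_univ s)
      omega
    have heq : Q * u s = ∏ s1, x (eS s1) ^ (((qv s1 : ℤ) + C' s s1).toNat) := by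
      rw [hQ, hu, ap_prod_pow_eq_zpow, ap_prod_zpow_add _ (fun s1 => hx0 _)]
      exact Finset.prod_congr rfl fun s1 _ => by
        rw [← zpow_natCast, Int.toNat_of_nonneg (hnn s1)]
    rw [heq]; exact prod_mem fun s1 _ => pow_mem (hx _) _
  -- the ring `B = R₁[u]`
  set B : Subalgebra k K := Algebra.adjoin k ((R₁ : Set K) ∪ Set.range u) with hB
  have hR₁B : R₁ ≤ B := fun w hw => Algebra.subset_adjoin (Or.inl hw)
  have huB : ∀ s, u s ∈ B := fun s => Algebra.subset_adjoin (Or.inr ⟨s, rfl⟩)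
  have hBO : B.toSubring ≤ O.toSubring := by
    intro w hw
    refine (Algebra.adjoin_le (S := { O.toSubring with algebraMap_mem' := fun c => hk c }) ?_) hw
    rintro w (hw | ⟨s, rfl⟩)
    · exact hR₁O hw
    · exact huO s
  have hBW : B.toSubring ≤ W.toSubring := fun w hw => hOW (hBO hw)
  have hBFG : B.FG := by
    obtain ⟨s₁, hs₁⟩ := hR₁FG
    refine ⟨s₁ ∪ Finset.univ.image u, ?_⟩
    rw [Finset.coe_union, Finset.coe_image, Finset.coe_univ, Set.image_univ, Algebra.adjoin_union, hs₁, hB,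
      Algebra.adjoin_union, Algebra.adjoin_eq]
  have hQB : Q ∈ B := hR₁B (hRR₁ hQR)
  have hxTB : ∀ t, xT t ∈ B := fun t => hR₁B (hxT t)
  -- every `W`-small element of `B` is thrown into `(x_T)B` by a power of `Q`
  have hthrowB : ∀ (τ : K) (hτ : τ ∈ B), W.valuation τ < 1 → ∃ N : ℕ,
      (⟨Q ^ N * τ, mul_mem (pow_mem hQB N) hτ⟩ : B.toSubring) ∈
        Ideal.span (Set.range fun t => (⟨xT t, hxTB t⟩ : B.toSubring)) := by
    intro τ hτ hτW
    obtain ⟨N, hN⟩ := ap_exists_pow_mul_mem R₁ u Q (hRR₁ hQR) (fun s => hRR₁ (hQu s)) τ hτ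
    refine ⟨N, ?_⟩
    have hsmall : W.valuation (Q ^ N * τ) < 1 := by
      rw [map_mul, map_pow, hQu1, one_pow, one_mul]; exact hτW
    have hmem : (⟨Q ^ N * τ, hN⟩ : R₁.toSubring) ∈
        Ideal.comap (Subring.inclusion hR₁W) (maximalIdeal W) := by
      rw [Ideal.mem_comap, ValuationSubring.valuation_lt_one_iff]; exact hsmall
    rw [← hspan₁] at hmem
    obtain ⟨c, hc⟩ := Ideal.mem_span_range_iff_exists_fun.mp hmem
    have hcK : (∑ t, (c t : K) * xT t) = Q ^ N * τ := by
      have := congrArg (fun w : R₁.toSubring => (w : K)) hc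
      simp only [AddSubmonoidClass.coe_finsetSum, Subring.coe_mul] at this
      exact this
    have : (⟨Q ^ N * τ, mul_mem (pow_mem hQB N) hτ⟩ : B.toSubring) =
        ∑ t, (⟨(c t : K), hR₁B (c t).2⟩ : B.toSubring) * ⟨xT t, hxTB t⟩ :=
      Subtype.ext (by push_cast; exact hcK.symm)
    rw [this]
    exact Submodule.sum_mem _ fun t _ => Ideal.mul_mem_left _ _ (Ideal.subset_span ⟨t, rfl⟩)
  -- one exponent `N₀` for all (`B` is noetherian)
  haveI : Algebra.FiniteType k B := (Subalgebra.fg_iff_finiteType B).mp hBFG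
  haveI hBnoeth : IsNoetherianRing B := Algebra.FiniteType.isNoetherianRing k B
  haveI : IsNoetherianRing B.toSubring := hBnoeth
  obtain ⟨N₀, hN₀⟩ := ap_exists_uniform_pow
    (Ideal.comap (Subring.inclusion hBW) (maximalIdeal W))
    (Ideal.span (Set.range fun t => (⟨xT t, hxTB t⟩ : B.toSubring))) (⟨Q, hQB⟩ : B.toSubring)
    (by
      intro τ hτ
      rw [Ideal.mem_comap, ValuationSubring.valuation_lt_one_iff] at hτ
      obtain ⟨N, hN⟩ := hthrowB τ τ.2 hτ
      exact ⟨N, by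
        have : (⟨Q, hQB⟩ : B.toSubring) ^ N * τ = ⟨Q ^ N * τ, mul_mem (pow_mem hQB N) τ.2⟩ :=
          Subtype.ext (by push_cast; rfl)
        rw [this]; exact hN⟩)
  have hthrow : ∀ (τ : K) (hτ : τ ∈ B), W.valuation τ < 1 →
      (⟨Q ^ N₀ * τ, mul_mem (pow_mem hQB N₀) hτ⟩ : B.toSubring) ∈
        Ideal.span (Set.range fun t => (⟨xT t, hxTB t⟩ : B.toSubring)) := by
    intro τ hτ hτW
    have h1 := hN₀ ⟨τ, hτ⟩ (by rw [Ideal.mem_comap, ValuationSubring.valuation_lt_one_iff]; exact hτW)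
    have : (⟨Q, hQB⟩ : B.toSubring) ^ N₀ * ⟨τ, hτ⟩ = ⟨Q ^ N₀ * τ, mul_mem (pow_mem hQB N₀) hτ⟩ :=
      Subtype.ext (by push_cast; rfl)
    rw [this] at h1; exact h1
  -- the top exponents of the `h j` after STEP 1
  choose e₁ he₁ using hhj₁
  have hpureT : ∀ j, (¬ ∀ t, h j (eT t) = 0) → ∃ t, e₁ j t ≠ 0 := by
    intro j hj
    by_contra h0
    push Not at h0
    apply hj
    have h1 : (∏ t, x (eT t) ^ (h j (eT t))) = 1 := by
      rw [he₁ j]; exact Finset.prod_eq_one fun t _ => by rw [h0 t, pow_zero]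
    have h2 : (∏ t, W.valuation (x (eT t)) ^ (h j (eT t))) = 1 := by
      have : W.valuation (∏ t, x (eT t) ^ (h j (eT t))) = ∏ t, W.valuation (x (eT t)) ^ (h j (eT t)) := by
        rw [map_prod]; exact Finset.prod_congr rfl fun t _ => map_zpow₀ _ _ _
      rw [← this, h1, map_one]
    have := hWind (fun t => h j (eT t)) h2
    exact fun t => congrFun this t
  set t₀ : Fin nT := eT.symm ⟨i₀, hi₀⟩ with ht₀
  have htsel : ∀ j, ∃ t, (¬ ∀ t, h j (eT t) = 0) → e₁ j t ≠ 0 := by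
    intro j
    by_cases hj : ∀ t, h j (eT t) = 0
    · exact ⟨t₀, fun h => absurd hj h⟩
    · obtain ⟨t, ht⟩ := hpureT j hj; exact ⟨t, fun _ => ht⟩
  choose tsel htsel using htsel
  -- `u`-exponents of the lower parts of the `h j`
  set g : Fin l → Fin nS → ℤ := fun j s => ∑ s1, h j (eS s1) * (D' s1 s : ℤ) with hg
  have hgmon : ∀ j, (∏ s1, x (eS s1) ^ (h j (eS s1))) = ∏ s, u s ^ (g j s) := by
    intro j
    simp_rw [hxu]
    exact ap_prod_zpow_matrix u hu0 (fun s1 s => (D' s1 s : ℤ)) (fun s1 => h j (eS s1))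
  -- the divisor exponents
  set mv : Fin nT → Fin nS → ℕ := fun t s => ∑ j, (if tsel j = t then (g j s).natAbs else 0) with hmv
  set bsum : Fin nS → ℕ := fun s => ∑ j, β j s with hbsum
  set qD : Fin nS → ℕ := fun s => ∑ s1, qv s1 * D' s1 s with hqD
  set dv : Fin nT → Fin nS → ℕ := fun t s => N₀ * qD s + bsum s + mv t s with hdv
  have hQmon : Q = ∏ s, u s ^ (qD s : ℤ) := by
    rw [hQ]
    have : ∀ s1, x (eS s1) ^ (qv s1) = (∏ s, u s ^ ((D' s1 s : ℤ))) ^ ((qv s1 : ℤ)) := by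
      intro s1; rw [hxu s1, zpow_natCast]
    simp_rw [this]
    rw [ap_prod_zpow_matrix u hu0 (fun s1 s => (D' s1 s : ℤ)) (fun s1 => (qv s1 : ℤ))]
    refine Finset.prod_congr rfl fun s _ => ?_
    congr 1; rw [hqD]; push_cast; rfl
  set E : Fin nT → K := fun t => ∏ s, u s ^ (bsum s + mv t s) with hE
  have hEB : ∀ t, E t ∈ B := fun t => prod_mem fun s _ => pow_mem (huB s) _
  have hE0 : ∀ t, E t ≠ 0 := fun t => Finset.prod_ne_zero_iff.mpr fun s _ => pow_ne_zero _ (hu0 s)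
  have hEu : ∀ t, W.valuation (E t) = 1 := by
    intro t; rw [hE, map_prod]; exact Finset.prod_eq_one fun s _ => by rw [map_pow, huu, one_pow]
  have hQE : ∀ t, Q ^ N₀ * E t = ∏ s, u s ^ (dv t s : ℤ) := by
    intro t
    have h1 : E t = ∏ s, u s ^ ((bsum s + mv t s : ℕ) : ℤ) := by
      rw [hE]; exact ap_prod_pow_eq_zpow _ _
    rw [h1, hQmon, ← zpow_natCast, ap_prod_zpow_zpow, ap_prod_zpow_add u hu0]
    refine Finset.prod_congr rfl fun s _ => ?_
    congr 1; rw [hdv]; push_cast; ring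
  -- the new top parameters `z t = x_T t / (Q^N₀ E t)` and the ring `R₃ = B[z]`
  set z : Fin nT → K := fun t => xT t / (Q ^ N₀ * E t) with hz
  have hzW1 : ∀ t, W.valuation (z t) = W.valuation (xT t) := by
    intro t; rw [hz]; simp only []; rw [map_div₀, map_mul, map_pow, hQu1, hEu, one_pow, one_mul, div_one]
  have hzW : ∀ t, W.valuation (z t) < 1 := fun t => by rw [hzW1]; exact hxTlt t
  have hzO : ∀ t, z t ∈ O := fun t => (O.valuation_le_one_iff _).mp (hWO _ (hzW t)).le
  have hz0 : ∀ t, z t ≠ 0 := fun t => div_ne_zero (hxT0 t) (mul_ne_zero (pow_ne_zero _ hQ0) (hE0 t))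
  set R₃ : Subalgebra k K := Algebra.adjoin k ((B : Set K) ∪ Set.range z) with hR₃
  have hBR₃ : B ≤ R₃ := fun w hw => Algebra.subset_adjoin (Or.inl hw)
  have hzR₃ : ∀ t, z t ∈ R₃ := fun t => Algebra.subset_adjoin (Or.inr ⟨t, rfl⟩)
  have hR₃O : R₃.toSubring ≤ O.toSubring := by
    intro w hw
    refine (Algebra.adjoin_le (S := { O.toSubring with algebraMap_mem' := fun c => hk c }) ?_) hw
    rintro w (hw | ⟨t, rfl⟩)
    · exact hBO hw
    · exact hzO t
  have hR₃W : R₃.toSubring ≤ W.toSubring := fun w hw => hOW (hR₃O hw)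
  have hspan₃ := ap_span_eq_comap_type2 W B xT hxTB Q hQB hQ0 N₀ hthrow E hEB hE0 z
    (fun t => rfl) hzW R₃ hR₃ hzR₃ hR₃W
  have hxTz : ∀ t, xT t = z t * ∏ s, u s ^ (dv t s : ℤ) := by
    intro t; rw [← hQE, hz]; simp only []
    rw [div_mul_cancel₀ _ (mul_ne_zero (pow_ne_zero _ hQ0) (hE0 t))]
  -- residues of `B` and `R₃` lie in `Rb'`, and every element of `Rb'` lifts to `B ⊆ R₃`
  have hπB : ∀ (w : K) (hw : w ∈ B), residue W ⟨w, hBW hw⟩ ∈ Rb' := fun w hw =>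
    ap_residue_adjoin_mem W Rb' R₁ (Set.range u) (fun r hr => hBW (by rw [hB]; exact hr))
      (fun r hr _ => hRbRb' (hπR₁ r hr)) (by rintro _ ⟨s, rfl⟩ _; rw [huπ s]; exact hxb' s) w
      (by rw [← hB]; exact hw) _
  have hπR₃ : ∀ (w : K) (hw : w ∈ R₃), residue W ⟨w, hR₃W hw⟩ ∈ Rb' := fun w hw =>
    ap_residue_adjoin_mem W Rb' B (Set.range z) (fun r hr => hR₃W (by rw [hR₃]; exact hr))
      (fun r hr _ => hπB r hr)
      (by rintro _ ⟨t, rfl⟩ hwW; rw [(ap_residue_eq_zero_iff W hwW).mpr (hzW t)]; exact Rb'.zero_mem) w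
      (by rw [← hR₃]; exact hw) _
  have hsurjB : ∀ rb ∈ Rb', ∃ (w : K) (hw : w ∈ B), residue W ⟨w, hBW hw⟩ = rb := by
    intro rb hrb
    have hrb' : rb ∈ Algebra.adjoin k ((Rb : Set (ResidueField W)) ∪ Set.range xb') := by rw [← hRb'eq]; exact hrb
    exact ap_residue_adjoin_surj W (Rb : Set (ResidueField W)) xb' B hBW
      (fun c => ⟨algebraMap k K c, B.algebraMap_mem c, (halg c).symm⟩)
      (fun rb hrb => by obtain ⟨r, hr, hrr⟩ := hπsurj rb hrb; exact ⟨r, hR₁B (hRR₁ hr), hrr⟩)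
      (fun s => ⟨u s, huB s, huπ s⟩) rb hrb'
  have hsurj₃ : ∀ rb ∈ Rb', ∃ (w : K) (hw : w ∈ R₃), residue W ⟨w, hR₃W hw⟩ = rb := by
    intro rb hrb
    obtain ⟨w, hw, hww⟩ := hsurjB rb hrb
    exact ⟨w, hBR₃ hw, hww⟩
  -- residues of ℕ-monomials in the `u`
  have humonπ : ∀ (b : Fin nS → ℕ) (hb : (∏ s, u s ^ (b s)) ∈ W),
      residue W ⟨∏ s, u s ^ (b s), hb⟩ = ∏ s, xb' s ^ (b s) := by
    intro b hb
    have : (⟨∏ s, u s ^ (b s), hb⟩ : W) = ∏ s, (⟨u s, huW s⟩ : W) ^ (b s) :=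
      Subtype.ext (by push_cast; rfl)
    rw [this, map_prod]
    exact Finset.prod_congr rfl fun s _ => by rw [map_pow, huπ]
  have humonB : ∀ (b : Fin nS → ℕ), (∏ s, u s ^ (b s)) ∈ B := fun b => prod_mem fun s _ => pow_mem (huB s) _
  have hR₃FG : R₃.FG := by
    obtain ⟨sB, hsB⟩ := hBFG
    refine ⟨sB ∪ Finset.univ.image z, ?_⟩
    rw [Finset.coe_union, Finset.coe_image, Finset.coe_univ, Set.image_univ, Algebra.adjoin_union, hsB, hR₃,
      Algebra.adjoin_union, Algebra.adjoin_eq]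
  have hmvge : ∀ j s, (g j s).natAbs ≤ mv (tsel j) s := by
    intro j s
    rw [hmv]
    refine le_trans ?_ (Finset.single_le_sum (f := fun j' => if tsel j' = tsel j then (g j' s).natAbs else 0)
      (fun _ _ => Nat.zero_le _) (Finset.mem_univ j))
    simp
  have hmvdv : ∀ t s, mv t s ≤ dv t s := by intro t s; rw [hdv]; simp only []; omega
  have hβle : ∀ j s, β j s ≤ bsum s := fun j s => by
    rw [hbsum]; exact Finset.single_le_sum (f := fun j => β j s) (fun _ _ => Nat.zero_le _) (Finset.mem_univ j)
  exact ⟨u, huW, Q, B, hBW, hBO, N₀, tsel, e₁, g, mv, bsum, dv, E, z, R₃, hR₃O, hR₃W, hzR₃, hxTB, hQB, hBR₃,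
    hu, hB, huu, hu0, huπ, huv, hxu, hQ0, hR₁B, huB, hthrow, htsel, he₁, hgmon, hmvge, hmvdv, hβle, hE, hQE, hz,
    hzW1, hzW, hz0, hR₃, hspan₃, hxTz, hπR₃, hsurj₃, hsurjB, humonπ, humonB, hR₃FG⟩

end Summit.ResolutionOfSingularities.ResolutionOfSingularities.Theorems.PfaffLine
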